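import Mathlib
import Literature.MathematicalPhysics.QuantumFieldTheory.Balaban1983to89.B9Thm37GlueTorusCov
import Literature.MathematicalPhysics.QuantumFieldTheory.Balaban1983to89.T4SliceOperatorData

/-!
# T⁴ programme, node NE3 — the COVARIANT REALISATION of the slice-operator model
# (pv21's covariant block mean `Q_U` over a comb realises `massKernel`; the Green's matrices of
# `Δ_U + a·Q_UᵀQ_U + N_g` and the resolvent telescoping of the slices, for EVERY transport)

ROLE.  The NE3 torus skeleton (`SliceTorusBlocks` … `SliceTorusFacesSkeleton`, this directory) is a SCALAR matrix model:
per level `j` a "non-Laplacian part" `K j = massKernel (cube j) τ_j m_j + Ng j` with `|τ_j| ≤ 1` (binders `hK`, `hτ`,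
`ham` of `SliceTorusSkeleton.ne3Shape_torus_of_printedStatements`), Green's matrices `G j`, and the slices
`T4SliceTelescoping.sliceKernel G K D`, whose telescoping `Σ_{i≤k} slice_i = G_k·D` (`sum_sliceKernel`) needs the two-sided
inverses `G j·K^full_j = 1 = K^full_j·G j`.  Bałaban's operators are End(𝔤)-valued; the lineage pv21 typed the covariant
objects in components (`B9Thm37GlueTorusCov`: a `Comb` = the contours Γ_{y,x} of [B9] (3.19) as a rooted forest to the
block base point, the transport `Comb.tr`, the covariant block mean `covMean`/`covMeanT` = Q_U/Q_Uᵀ, the operator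
`covLapCov K c w Rm a = D*D + a·Q_UᵀQ_U` on `St × Cp → ℝ` with `B9Thm37Glue.covD/covDT`, strictly positive for every
ISOMETRIC transport `Rm` — `posDef_covLapCov`).  THIS FILE is the junction [model, proved; finite sums, real matrices]:
 * §1 the transporter overlap `tau K Rm (x,i) (y,j) = Σ_k tr(x)_{ki}·tr(y)_{kj}` (= ((tr x)ᵀ(tr y))_{ij}): symmetric,
   `tau p p = 1`, `|tau p q| ≤ 1` for isometric `Rm` (Cauchy–Schwarz on the orthonormal columns `Comb.tr_orth`);
 * §2 the matrix of Q_UᵀQ_U (`gram`) is block-diagonal `w(β)²·tau` (`gram_apply`), i.e. for a constant block weight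
   `w₀` it IS `massKernel (K.blk ∘ Prod.fst) (tau K Rm) (w₀²)` (`gram_eq_massKernel`) — the skeleton's `hK`/`hτ` shape
   realised by a genuine covariant object on the internal-index fine type `St × Cp`, for EVERY transport;
 * §3 `lapMat` (the level-free matrix of Δ_U = D*D), `kFull = lapMat + a·gram + Ng` with a gauge-fixing form `Ng ⪰ 0`:
   `Matrix.PosDef` (transfer of pv21's positivity through `LinearMap.toMatrix'`), the Green's matrix `green = kFull⁻¹`
   is a two-sided inverse, symmetric and positive definite, and `(green·D)ᵀ = Dᵀ·green` (the skeleton's remark under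
   `hA1`: "G symmetric, so (G∇*)ᵀ = ∇G");
 * §4 level families (combs `Kc j` of the successive block structures on ONE fine lattice, weights `w j`, masses `a j`,
   forms `Ng j`): `kPart j = massKernel … (a j·w j²) + Ng j` (the skeleton's `K j`, by `rfl`), `kLev j = lapMat + kPart j`,
   `gLev j = (kLev j)⁻¹`; the slices of `kPart` and of `kLev` coincide (the Laplacian cancels in `K j − K (j+1)`), hence
   `Σ_{i≤k} sliceKernel gLev kPart D i = gLev k·D` for every isometric transport (`sum_sliceKernel_cov`);
 * §5 Bałaban's normalisation: block weight `L^{−jd}`, coarse adjoint factor `(L^j)^d`, mass `a·L^{−2j}` give the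
   skeleton's coefficient `m_j = a/(L^j)^{d+2}` (`balaban_mass_coeff`).
WHAT THIS BUYS for NE3 (nothing more): the binders `hK`/`hτ`/`ham`, the invertibility of the level operators and the
resolvent telescoping are THEOREMS for the covariant family at every transport, so the stability reading `hT31` ([B9]
Thm 3.1 = the ξ-UNIFORM, level-free decay) speaks about a CONCRETE typed operator family (reading (I′) pinned); pv21's
fixed-scale Combes–Thomas decay (`B9Thm37GlueTorusCovCT`) is NOT level-free — no NE3Shape theorem follows from it.  NOT
HERE: the comb on the torus carrier `TPt d (N·L^k)` with `blk := cube d k N L j`, the (3.35) instance (successors).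

Honest framing: finite-T⁴ ultraviolet bookkeeping about MINIMISERS (rung (B)+1 of the cell's ladder); no conditional of
the cell (`BetaPertH`, (B), (B^μ)) is used or hidden; nothing bears on infinite volume, a mass gap, or the Clay problem;
NE3 is NOT proved.  ABSOLUTE RULE of the cell kept: no internally-minted statement enters as a cited fact; nothing printed
is asserted; every declaration is a MODEL definition or a kernel-checked [folklore] theorem about pv21's component model;
no `sorry`, no axioms beyond Mathlib's.  PLACEMENT (human rule 2026-08-19): under `Summits/QuantumFields/BalabanUV/`;
imports `B9Thm37GlueTorusCov` (pv21) and `T4SliceOperatorData` (this lineage) where they landed, moves nothing.  Records: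
`t4/T4-EST-U1b-OSC.md` v1.24, `t4/T4-EST-NE3-P1.md` v2.23, `t4/b2b-balaban-t4-ne3-p1/g12/DESIGN.md` (cell `pub-balaban`).
-/

noncomputable section

open Finset Matrix

namespace Summit.QuantumFields.BalabanUV.T4Continuum.SliceCovariantModel

open Literature.MathematicalPhysics.QuantumFieldTheory.Balaban1983to89
open Literature.MathematicalPhysics.QuantumFieldTheory.Balaban1983to89.B9Thm37Glue (covD covDT IsTransposePair)
open Literature.MathematicalPhysics.QuantumFieldTheory.Balaban1983to89.B9Thm37GlueTorusCov
open Literature.MathematicalPhysics.QuantumFieldTheory.Balaban1983to89.T4SliceOperatorData (massKernel)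
open Literature.MathematicalPhysics.QuantumFieldTheory.Balaban1983to89.T4SliceTelescoping (sliceKernel sum_sliceKernel)

/-! ## §0  Transfer: symmetric positive endomorphisms of `X → ℝ` have positive definite matrices -/
section Transfer

variable {X : Type} [Fintype X] [DecidableEq X]

/-- `Σ_y u(y)·e_x(y) = u(x)`. [folklore] -/
theorem sum_mul_single_one (u : X → ℝ) (x : X) :
    ∑ y, u y * (Pi.single x (1 : ℝ) : X → ℝ) y = u x := by
  rw [Finset.sum_eq_single x (fun y _ hy => by rw [Pi.single_eq_of_ne hy, mul_zero])
    (fun h => absurd (Finset.mem_univ x) h), Pi.single_eq_same, mul_one]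

/-- `Σ_y e_x(y)·u(y) = u(x)`. [folklore] -/
theorem sum_single_one_mul (u : X → ℝ) (x : X) :
    ∑ y, (Pi.single x (1 : ℝ) : X → ℝ) y * u y = u x := by
  simp_rw [mul_comm _ (u _)]
  exact sum_mul_single_one u x

/-- A self-transpose endomorphism (for the component pairing) has a symmetric = Hermitian real matrix. [folklore] -/
theorem isHermitian_toMatrix' {A : Module.End ℝ (X → ℝ)} (hA : IsTransposePair A A) :
    (LinearMap.toMatrix' A).IsHermitian := by
  change (LinearMap.toMatrix' A)ᴴ = LinearMap.toMatrix' A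
  rw [conjTranspose_eq_transpose_of_trivial]
  ext i j
  rw [transpose_apply, LinearMap.toMatrix'_apply, LinearMap.toMatrix'_apply]
  have h := hA (Pi.single i 1) (Pi.single j 1)
  rwa [sum_mul_single_one, sum_single_one_mul] at h

/-- A self-transpose endomorphism with positive quadratic form `Σ_x f(x)(Af)(x) > 0` (`f ≠ 0`) has a positive definite
matrix. [folklore] -/
theorem posDef_toMatrix' {A : Module.End ℝ (X → ℝ)} (hA : IsTransposePair A A)
    (hpos : ∀ f : X → ℝ, f ≠ 0 → 0 < ∑ x, f x * A f x) : (LinearMap.toMatrix' A).PosDef :=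
  PosDef.of_dotProduct_mulVec_pos (isHermitian_toMatrix' hA) fun f hf => by
    rw [LinearMap.toMatrix'_mulVec, star_trivial]
    exact hpos f hf

omit [Fintype X] [DecidableEq X] in
/-- A positive definite real matrix is symmetric. [folklore] -/
theorem transpose_eq_of_posDef {M : Matrix X X ℝ} (hM : M.PosDef) : Mᵀ = M := by
  have h := hM.isHermitian
  change Mᴴ = M at h
  rwa [conjTranspose_eq_transpose_of_trivial] at h

end Transfer

/-! ## §1  The transporter overlap `τ` of a comb -/
section Overlap

variable {St Bd B Cp : Type} [Fintype Cp] [DecidableEq Cp] {src tgt : Bd → St} (K : Comb src tgt B)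
  (Rm : Bd → Cp → Cp → ℝ)

/-- The TRANSPORTER OVERLAP `τ((x,i),(y,j)) = Σ_k tr(x)_{ki}·tr(y)_{kj} = ((tr x)ᵀ(tr y))_{ij}` of two sites-with-colour:
the colour matrix relating the transports of `x` and of `y` to the base point (MODEL; for `x`, `y` in one block it is the
component form of R(U(Γ_{y₀,x}))⁻¹R(U(Γ_{y₀,y}))). [model] -/
def tau (p q : St × Cp) : ℝ := ∑ k, K.tr Rm p.1 k p.2 * K.tr Rm q.1 k q.2

/-- `τ` is symmetric. [folklore] -/
theorem tau_comm (p q : St × Cp) : tau K Rm p q = tau K Rm q p :=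
  Finset.sum_congr rfl fun _ _ => mul_comm _ _

/-- `τ(p,p) = 1` for an isometric transport (orthonormal columns, `Comb.tr_orth`). [folklore] -/
theorem tau_self (hRm : ∀ b i j, ∑ k, Rm b k i * Rm b k j = if i = j then (1 : ℝ) else 0) (p : St × Cp) :
    tau K Rm p p = 1 := by
  unfold tau
  rw [K.tr_orth Rm hRm p.1 p.2 p.2, if_pos rfl]

/-- `|τ(p,q)| ≤ 1` for an isometric transport: Cauchy–Schwarz on two unit columns. [folklore] -/
theorem abs_tau_le_one (hRm : ∀ b i j, ∑ k, Rm b k i * Rm b k j = if i = j then (1 : ℝ) else 0)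
    (p q : St × Cp) : |tau K Rm p q| ≤ 1 := by
  rw [← sq_le_one_iff_abs_le_one]
  have h1 : ∀ r : St × Cp, ∑ k, K.tr Rm r.1 k r.2 ^ 2 = 1 := fun r => by
    simp_rw [sq]
    rw [K.tr_orth Rm hRm r.1 r.2 r.2, if_pos rfl]
  have h := Finset.sum_mul_sq_le_sq_mul_sq Finset.univ (fun k => K.tr Rm p.1 k p.2) (fun k => K.tr Rm q.1 k q.2)
  rwa [h1 p, h1 q, mul_one] at h

end Overlap

/-! ## §2  The matrix of `Q_UᵀQ_U` is the mass kernel -/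
section Gram

variable {St Bd B Cp : Type} [Fintype St] [DecidableEq St] [DecidableEq B] [Fintype Cp] [DecidableEq Cp]
  {src tgt : Bd → St} (K : Comb src tgt B) (w : B → ℝ) (Rm : Bd → Cp → Cp → ℝ)

/-- The covariant mean of a unit impulse at `q = (y,j)`: `(Q_U e_q)(β,i) = w(β)·tr(y)_{ij}` on the block `β` of `y`,
`0` elsewhere. [folklore] -/
theorem covMean_single (q : St × Cp) (r : B × Cp) :
    covMean K w Rm (Pi.single q 1) r = if K.blk q.1 = r.1 then w r.1 * K.tr Rm q.1 r.2 q.2 else 0 := by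
  rw [covMean_apply]
  have hin : ∀ x, (∑ j, K.tr Rm x r.2 j * (Pi.single q (1 : ℝ) : St × Cp → ℝ) (x, j)) =
      if x = q.1 then K.tr Rm x r.2 q.2 else 0 := by
    intro x
    split_ifs with hx
    · subst hx
      rw [Finset.sum_eq_single q.2 (fun j _ hj => ?_) (fun h => absurd (Finset.mem_univ _) h)]
      · rw [show (q.1, q.2) = q from rfl, Pi.single_eq_same, mul_one]
      · rw [Pi.single_eq_of_ne (fun h : (q.1, j) = q => hj (congrArg Prod.snd h)), mul_zero]
    · exact Finset.sum_eq_zero fun j _ => by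
        rw [Pi.single_eq_of_ne (fun h : (x, j) = q => hx (congrArg Prod.fst h)), mul_zero]
  simp_rw [hin]
  rw [Finset.sum_eq_single q.1 (fun x _ hx => by rw [if_neg hx, ite_self])
    (fun h => absurd (Finset.mem_univ _) h), if_pos rfl]
  split_ifs <;> simp

/-- The GRAM MATRIX of the covariant mean: the real matrix of `Q_UᵀQ_U` on `St × Cp` (MODEL of the matrix of
Q′\*Q′ in (3.23)–(3.24), up to the normalisation of §5). [model] -/
def gram : Matrix (St × Cp) (St × Cp) ℝ := LinearMap.toMatrix' (covMeanT K w Rm ∘ₗ covMean K w Rm)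

/-- **`Q_UᵀQ_U` is block-diagonal with entries `w(β)²·τ`**: `gram (x,i) (y,j) = w(blk x)²·τ((x,i),(y,j))` if
`blk x = blk y`, else `0`. [folklore] -/
theorem gram_apply (p q : St × Cp) :
    gram K w Rm p q = if K.blk p.1 = K.blk q.1 then w (K.blk p.1) ^ 2 * tau K Rm p q else 0 := by
  rw [gram, LinearMap.toMatrix'_apply, LinearMap.comp_apply, covMeanT_apply]
  simp_rw [covMean_single]
  by_cases h : K.blk p.1 = K.blk q.1
  · rw [if_pos h]
    simp_rw [if_pos h.symm]
    rw [tau, Finset.mul_sum]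
    exact Finset.sum_congr rfl fun i _ => by ring
  · rw [if_neg h]
    simp_rw [if_neg (Ne.symm h)]
    simp

/-- **For a constant block weight the Gram matrix IS the skeleton's mass kernel**:
`gram K (fun _ => w₀) Rm = massKernel (blk ∘ fst) (τ K Rm) (w₀²)`. [folklore] -/
theorem gram_eq_massKernel (w₀ : ℝ) :
    gram K (fun _ => w₀) Rm = massKernel (fun p : St × Cp => K.blk p.1) (tau K Rm) (w₀ ^ 2) := by
  ext p q
  rw [gram_apply]
  rfl

/-- `a·massKernel blk τ m = massKernel blk τ (a·m)`. [folklore] -/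
theorem smul_massKernel {X S : Type} [DecidableEq S] (blk : X → S) (τ : X → X → ℝ) (a m : ℝ) :
    a • massKernel blk τ m = massKernel blk τ (a * m) := by
  ext z y
  simp only [massKernel, Matrix.smul_apply, smul_eq_mul]
  split_ifs <;> ring

end Gram

/-! ## §3  The level operator `Δ_U + a·Q_UᵀQ_U + N_g`, its positivity and its Green's matrix -/
section Green

variable {St Bd B Cp : Type} [Fintype St] [DecidableEq St] [Fintype Bd] [DecidableEq B] [Fintype Cp]
  [DecidableEq Cp] {src tgt : Bd → St} (K : Comb src tgt B) (c : Bd → ℝ) (w : B → ℝ) (Rm : Bd → Cp → Cp → ℝ)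

/-- The matrix of the covariant Laplacian `Δ_U = D*D` on `St × Cp` (MODEL; it does not see the block structure, hence is
the SAME at every level). [model] -/
def lapMat (src tgt : Bd → St) (c : Bd → ℝ) (Rm : Bd → Cp → Cp → ℝ) : Matrix (St × Cp) (St × Cp) ℝ :=
  LinearMap.toMatrix' (covDT src tgt c Rm ∘ₗ covD src tgt c Rm)

/-- The matrix of pv21's `covLapCov K c w Rm a = D*D + a·Q_UᵀQ_U` is `lapMat + a·gram`. [folklore] -/
theorem toMatrix'_covLapCov (a : ℝ) :
    LinearMap.toMatrix' (covLapCov K c w Rm a) = lapMat src tgt c Rm + a • gram K w Rm := by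
  unfold covLapCov lapMat gram
  rw [map_add, map_smul]

/-- With a constant block weight: matrix of `D*D + a·Q_UᵀQ_U` = `lapMat + massKernel (blk ∘ fst) τ (a·w₀²)`. [folklore] -/
theorem toMatrix'_covLapCov_const (w₀ a : ℝ) :
    LinearMap.toMatrix' (covLapCov K c (fun _ => w₀) Rm a) =
      lapMat src tgt c Rm + massKernel (fun p : St × Cp => K.blk p.1) (tau K Rm) (a * w₀ ^ 2) := by
  rw [toMatrix'_covLapCov, gram_eq_massKernel, smul_massKernel]

/-- The FULL LEVEL OPERATOR `Δ_U + a·Q_UᵀQ_U + N_g` as a real matrix, `N_g` a further quadratic form (MODEL of the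
gauge-fixing term of the propagators of [B9] §3; here an arbitrary matrix, positive semidefinite in the theorems). [model] -/
def kFull (a : ℝ) (Ng : Matrix (St × Cp) (St × Cp) ℝ) : Matrix (St × Cp) (St × Cp) ℝ :=
  LinearMap.toMatrix' (covLapCov K c w Rm a) + Ng

/-- The GREEN'S MATRIX `G = (Δ_U + a·Q_UᵀQ_U + N_g)⁻¹` (MODEL of the background-field propagator of the level). [model] -/
def green (a : ℝ) (Ng : Matrix (St × Cp) (St × Cp) ℝ) : Matrix (St × Cp) (St × Cp) ℝ := (kFull K c w Rm a Ng)⁻¹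

variable [Fintype B]

/-- **Positivity for EVERY isometric transport**: `Δ_U + a·Q_UᵀQ_U + N_g` is positive definite for `a > 0`, non-zero
bond and block weights and `N_g ⪰ 0` (transfer of pv21's `posDef_covLapCov`). [folklore] -/
theorem posDef_kFull (hRm : ∀ b i j, ∑ k, Rm b k i * Rm b k j = if i = j then (1 : ℝ) else 0)
    (hc : ∀ b, c b ≠ 0) (hw : ∀ β, w β ≠ 0) {a : ℝ} (ha : 0 < a) {Ng : Matrix (St × Cp) (St × Cp) ℝ}
    (hNg : Ng.PosSemidef) : (kFull K c w Rm a Ng).PosDef :=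
  (posDef_toMatrix' (isTransposePair_covLapCov K c w Rm a) (posDef_covLapCov K c w Rm hRm hc hw ha)).add_posSemidef
    hNg

variable {K c w Rm}

/-- The determinant of the level operator is a unit. [folklore] -/
theorem isUnit_det_kFull (hRm : ∀ b i j, ∑ k, Rm b k i * Rm b k j = if i = j then (1 : ℝ) else 0)
    (hc : ∀ b, c b ≠ 0) (hw : ∀ β, w β ≠ 0) {a : ℝ} (ha : 0 < a) {Ng : Matrix (St × Cp) (St × Cp) ℝ}
    (hNg : Ng.PosSemidef) : IsUnit (kFull K c w Rm a Ng).det :=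
  (isUnit_iff_isUnit_det _).mp (posDef_kFull K c w Rm hRm hc hw ha hNg).isUnit

/-- `G·K^full = 1`. [folklore] -/
theorem green_mul_kFull (hRm : ∀ b i j, ∑ k, Rm b k i * Rm b k j = if i = j then (1 : ℝ) else 0)
    (hc : ∀ b, c b ≠ 0) (hw : ∀ β, w β ≠ 0) {a : ℝ} (ha : 0 < a) {Ng : Matrix (St × Cp) (St × Cp) ℝ}
    (hNg : Ng.PosSemidef) : green K c w Rm a Ng * kFull K c w Rm a Ng = 1 :=
  nonsing_inv_mul _ (isUnit_det_kFull hRm hc hw ha hNg)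

/-- `K^full·G = 1`. [folklore] -/
theorem kFull_mul_green (hRm : ∀ b i j, ∑ k, Rm b k i * Rm b k j = if i = j then (1 : ℝ) else 0)
    (hc : ∀ b, c b ≠ 0) (hw : ∀ β, w β ≠ 0) {a : ℝ} (ha : 0 < a) {Ng : Matrix (St × Cp) (St × Cp) ℝ}
    (hNg : Ng.PosSemidef) : kFull K c w Rm a Ng * green K c w Rm a Ng = 1 :=
  mul_nonsing_inv _ (isUnit_det_kFull hRm hc hw ha hNg)

/-- The level operator is symmetric. [folklore] -/
theorem kFull_transpose (hRm : ∀ b i j, ∑ k, Rm b k i * Rm b k j = if i = j then (1 : ℝ) else 0)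
    (hc : ∀ b, c b ≠ 0) (hw : ∀ β, w β ≠ 0) {a : ℝ} (ha : 0 < a) {Ng : Matrix (St × Cp) (St × Cp) ℝ}
    (hNg : Ng.PosSemidef) : (kFull K c w Rm a Ng)ᵀ = kFull K c w Rm a Ng :=
  transpose_eq_of_posDef (posDef_kFull K c w Rm hRm hc hw ha hNg)

/-- **The Green's matrix is symmetric** (so `(G·D)ᵀ = Dᵀ·G`: the B-side observation of the skeleton is the A-side one
of the transposed kernel). [folklore] -/
theorem green_transpose (hRm : ∀ b i j, ∑ k, Rm b k i * Rm b k j = if i = j then (1 : ℝ) else 0)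
    (hc : ∀ b, c b ≠ 0) (hw : ∀ β, w β ≠ 0) {a : ℝ} (ha : 0 < a) {Ng : Matrix (St × Cp) (St × Cp) ℝ}
    (hNg : Ng.PosSemidef) : (green K c w Rm a Ng)ᵀ = green K c w Rm a Ng := by
  rw [green, transpose_nonsing_inv, kFull_transpose hRm hc hw ha hNg]

/-- The Green's matrix is positive definite. [folklore] -/
theorem posDef_green (hRm : ∀ b i j, ∑ k, Rm b k i * Rm b k j = if i = j then (1 : ℝ) else 0)
    (hc : ∀ b, c b ≠ 0) (hw : ∀ β, w β ≠ 0) {a : ℝ} (ha : 0 < a) {Ng : Matrix (St × Cp) (St × Cp) ℝ}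
    (hNg : Ng.PosSemidef) : (green K c w Rm a Ng).PosDef :=
  (posDef_kFull K c w Rm hRm hc hw ha hNg).inv

/-- `(G·D)ᵀ = Dᵀ·G`. [folklore] -/
theorem transpose_green_mul (hRm : ∀ b i j, ∑ k, Rm b k i * Rm b k j = if i = j then (1 : ℝ) else 0)
    (hc : ∀ b, c b ≠ 0) (hw : ∀ β, w β ≠ 0) {a : ℝ} (ha : 0 < a) {Ng : Matrix (St × Cp) (St × Cp) ℝ}
    (hNg : Ng.PosSemidef) (D : Matrix (St × Cp) (St × Cp) ℝ) :
    (green K c w Rm a Ng * D)ᵀ = Dᵀ * green K c w Rm a Ng := by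
  rw [transpose_mul, green_transpose hRm hc hw ha hNg]

end Green

/-! ## §4  Level families on one fine lattice and the resolvent telescoping of the slices -/
section Levels

variable {St Bd Cp : Type} [Fintype Cp] [DecidableEq Cp] {src tgt : Bd → St} {Bk : ℕ → Type}
  [∀ j, DecidableEq (Bk j)] (Kc : ∀ j, Comb src tgt (Bk j)) (c : Bd → ℝ) (Rm : Bd → Cp → Cp → ℝ) (w a : ℕ → ℝ)
  (Ng : ℕ → Matrix (St × Cp) (St × Cp) ℝ)

/-- The NON-LAPLACIAN PART of the level-`j` operator: `a_j·Q_jᵀQ_j + N_{g,j}` = `massKernel (blk_j ∘ fst) τ_j (a_j·w_j²)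
+ Ng j` — literally the shape of the skeleton's binder `hK` (MODEL). [model] -/
def kPart (j : ℕ) : Matrix (St × Cp) (St × Cp) ℝ :=
  massKernel (fun p : St × Cp => (Kc j).blk p.1) (tau (Kc j) Rm) (a j * w j ^ 2) + Ng j

/-- **The skeleton's operator-model binders hold for the covariant family** (shape of `hK`, `hτ` of
`SliceTorusSkeleton.sliceKernel_bound_torus_of_kernelBounds` / `T4SliceOperatorData.sliceKernel_bound_of_printedType`,
on the internal-index fine type `St × Cp` with block maps `blk_j ∘ Prod.fst`): `kPart j = massKernel (blk_j ∘ fst) τ_j m_j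
+ Ng j` with `m_j = a_j·w_j²` and `|τ_j| ≤ 1`, for EVERY isometric transport. [folklore] -/
theorem opModel_binders (hRm : ∀ b i j, ∑ k, Rm b k i * Rm b k j = if i = j then (1 : ℝ) else 0) :
    (∀ j, kPart Kc Rm w a Ng j =
        massKernel (fun p : St × Cp => (Kc j).blk p.1) (tau (Kc j) Rm) (a j * w j ^ 2) + Ng j) ∧
      ∀ j (z y : St × Cp), |tau (Kc j) Rm z y| ≤ 1 :=
  ⟨fun _ => rfl, fun j z y => abs_tau_le_one (Kc j) Rm hRm z y⟩

variable [Fintype St] [DecidableEq St] [Fintype Bd]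

/-- The level-`j` operator `Δ_U + a_j·Q_jᵀQ_j + N_{g,j}` (MODEL). [model] -/
def kLev (j : ℕ) : Matrix (St × Cp) (St × Cp) ℝ := lapMat src tgt c Rm + kPart Kc Rm w a Ng j

/-- The level-`j` Green's matrix `G_j = (Δ_U + a_j·Q_jᵀQ_j + N_{g,j})⁻¹` (MODEL). [model] -/
def gLev (j : ℕ) : Matrix (St × Cp) (St × Cp) ℝ := (kLev Kc c Rm w a Ng j)⁻¹

/-- The level operator is pv21's `covLapCov` at the level-`j` comb plus the gauge-fixing form. [folklore] -/
theorem kLev_eq_kFull (j : ℕ) : kLev Kc c Rm w a Ng j = kFull (Kc j) c (fun _ => w j) Rm (a j) (Ng j) := by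
  unfold kLev kPart kFull
  rw [toMatrix'_covLapCov_const, add_assoc]

/-- The level Green's matrix is the `green` of §3 at the level-`j` comb. [folklore] -/
theorem gLev_eq_green (j : ℕ) : gLev Kc c Rm w a Ng j = green (Kc j) c (fun _ => w j) Rm (a j) (Ng j) := by
  unfold gLev green
  rw [kLev_eq_kFull]

/-- **The Laplacian cancels in the level differences**: `K^full_i − K^full_{i+1} = kPart i − kPart (i+1)`. [folklore] -/
theorem kLev_sub_kLev (i : ℕ) :
    kLev Kc c Rm w a Ng i - kLev Kc c Rm w a Ng (i + 1) = kPart Kc Rm w a Ng i - kPart Kc Rm w a Ng (i + 1) :=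
  add_sub_add_left_eq_sub _ _ _

/-- Hence the slices built from the non-Laplacian parts ARE the slices of the full level operators. [folklore] -/
theorem sliceKernel_kPart (D : Matrix (St × Cp) (St × Cp) ℝ) :
    sliceKernel (gLev Kc c Rm w a Ng) (kPart Kc Rm w a Ng) D = sliceKernel (gLev Kc c Rm w a Ng) (kLev Kc c Rm w a Ng) D := by
  funext i x y
  cases i with
  | zero => rfl
  | succ i => simp only [sliceKernel, kLev_sub_kLev]

variable [∀ j, Fintype (Bk j)] {Kc c Rm w a Ng}

/-- `G_j·K^full_j = 1` at every level, for every isometric transport. [folklore] -/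
theorem gLev_mul_kLev (hRm : ∀ b i j, ∑ k, Rm b k i * Rm b k j = if i = j then (1 : ℝ) else 0)
    (hc : ∀ b, c b ≠ 0) (hw : ∀ j, w j ≠ 0) (ha : ∀ j, 0 < a j) (hNg : ∀ j, (Ng j).PosSemidef) (j : ℕ) :
    gLev Kc c Rm w a Ng j * kLev Kc c Rm w a Ng j = 1 := by
  rw [gLev_eq_green, kLev_eq_kFull]
  exact green_mul_kFull hRm hc (fun _ => hw j) (ha j) (hNg j)

/-- `K^full_j·G_j = 1` at every level, for every isometric transport. [folklore] -/
theorem kLev_mul_gLev (hRm : ∀ b i j, ∑ k, Rm b k i * Rm b k j = if i = j then (1 : ℝ) else 0)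
    (hc : ∀ b, c b ≠ 0) (hw : ∀ j, w j ≠ 0) (ha : ∀ j, 0 < a j) (hNg : ∀ j, (Ng j).PosSemidef) (j : ℕ) :
    kLev Kc c Rm w a Ng j * gLev Kc c Rm w a Ng j = 1 := by
  rw [gLev_eq_green, kLev_eq_kFull]
  exact kFull_mul_green hRm hc (fun _ => hw j) (ha j) (hNg j)

/-- `G_j` is symmetric at every level. [folklore] -/
theorem gLev_transpose (hRm : ∀ b i j, ∑ k, Rm b k i * Rm b k j = if i = j then (1 : ℝ) else 0)
    (hc : ∀ b, c b ≠ 0) (hw : ∀ j, w j ≠ 0) (ha : ∀ j, 0 < a j) (hNg : ∀ j, (Ng j).PosSemidef) (j : ℕ) :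
    (gLev Kc c Rm w a Ng j)ᵀ = gLev Kc c Rm w a Ng j := by
  rw [gLev_eq_green]
  exact green_transpose hRm hc (fun _ => hw j) (ha j) (hNg j)

/-- **RESOLVENT TELESCOPING FOR THE COVARIANT FAMILY, AT EVERY ISOMETRIC TRANSPORT**: the `k + 1` slice kernels
`sliceKernel gLev kPart D i` sum to the entry of `G_k·D` — the hypothesis-free instance of
`T4SliceTelescoping.sum_sliceKernel` for the covariant model (its binders `G j·K j = 1 = K j·G j` discharged by §3). [folklore] -/
theorem sum_sliceKernel_cov (hRm : ∀ b i j, ∑ k, Rm b k i * Rm b k j = if i = j then (1 : ℝ) else 0)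
    (hc : ∀ b, c b ≠ 0) (hw : ∀ j, w j ≠ 0) (ha : ∀ j, 0 < a j) (hNg : ∀ j, (Ng j).PosSemidef)
    (D : Matrix (St × Cp) (St × Cp) ℝ) (k : ℕ) (x y : St × Cp) :
    ∑ i ∈ Finset.range (k + 1), sliceKernel (gLev Kc c Rm w a Ng) (kPart Kc Rm w a Ng) D i x y =
      (gLev Kc c Rm w a Ng k * D) x y := by
  rw [sliceKernel_kPart]
  exact sum_sliceKernel _ _ D (gLev_mul_kLev hRm hc hw ha hNg) (kLev_mul_gLev hRm hc hw ha hNg) k x y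

end Levels

/-! ## §5  Bałaban's normalisation of the mass coefficient -/
section Normalisation

/-- **`m_j = a/(L^j)^{d+2}`**: with the block weight `w_j = (L^j)^{−d}` of the `j`-fold mean ((3.19): `L^{−jd}`), the
coarse-lattice adjoint factor `(L^j)^d` (Q* = (L^j)^d·Qᵀ for the weighted pairings) and the mass `a·(L^j)^{−2}` of the
level-`j` averaging term, the coefficient `a_j·w_j²` of §4 is the skeleton's `am/(L^j)^{d+2}`. [folklore] -/
theorem balaban_mass_coeff {L : ℝ} (hL : 0 < L) (a : ℝ) (j d : ℕ) :
    (a / (L ^ j) ^ 2 * (L ^ j) ^ d) * ((L ^ j) ^ d)⁻¹ ^ 2 = a / (L ^ j) ^ (d + 2) := by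
  have h : (L ^ j) ≠ 0 := by positivity
  field_simp
  ring

/-- The resulting coefficient lies in the skeleton's admissible range `0 ≤ m_j ≤ amax/(L^j)^{d+2}` as soon as
`0 ≤ a ≤ amax` (the binder `ham`). [folklore] -/
theorem mass_coeff_range {L : ℝ} (hL : 0 < L) {a amax : ℝ} (ha : 0 ≤ a) (hamax : a ≤ amax) (j d : ℕ) :
    0 ≤ a / (L ^ j) ^ (d + 2) ∧ a / (L ^ j) ^ (d + 2) ≤ amax / (L ^ j) ^ (d + 2) := by
  have h : 0 < (L ^ j) ^ (d + 2) := by positivity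
  exact ⟨div_nonneg ha h.le, div_le_div_of_nonneg_right hamax h.le⟩

end Normalisation

end Summit.QuantumFields.BalabanUV.T4Continuum.SliceCovariantModel
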